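import Summits.QuantumFields.QCD.Theses.EulerDescent
import HarnessLib.Audit

/-!
# Birth skeleton (BC3) for the crux `RayDescent` (item stmt-QuantumFields-16900)

Route `EulerDescent` (sub-problem QCD), crux decl
`Summit.QuantumFields.QCD.Theses.EulerDescent.RayDescent` (rev 1; rank 2; "the NEW LEVER"):

  for every `N_f`, regularisation `reg` and candidate corner `mc`: IF eventually `mc(k)` is the least upper
  bound of the degenerate bare Wilson masses at which lattice QCD at coupling `β_k` is not massive (the
  INTRINSIC Wilson corner), AND `(reg.mcrit(k) − mc(k))·Z_m(k)/a_k → 0` (the PIN), AND leading-log mass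
  scaling, two-loop asymptotic scaling and `reg.mcrit(k) > −1` eventually, THEN for every positive tuple `m`,
  every `l ≥ 1`, every `Δ > 0`: `HasLatticeMassGap Δ` at `l·m` ⇒ `HasLatticeMassGap Δ'` at `m` for every
  `0 < Δ' < Δ/l` (Euler descent `Δ(m) ≥ Δ(l m)/l`).

Registered by the skeleton-registrar seat `planner-skel-stmt-QuantumFields-16900-0` (route re-audit bin
REPAIRABLE, 2026-08-17) as `Cruxes/RayDescent/Lines/birth.lean`.  It is the route-level BIRTH CERTIFICATE of
the crux (≥ 2 named stubs, a kernel-checked composition concluding the crux BY NAME, `sorry` only inside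
`stub_*`), deliberately LINE-NEUTRAL: it cuts the crux at its one typed joint — the PIN.  The crux asks the
Euler inequality for a regularisation whose critical mass is only `o(a/Z_m)`-close to the intrinsic corner;
every proof must therefore (i) prove the inequality along rays from the EXACT corner (the physics: the
trace-anomaly share of the lightest state is non-negative, Feynman–Hellmann on Lüscher's transfer matrix) and
(ii) show that the uniform lattice gap at a positive renormalised tuple does not see a sub-resolution,
flavour-blind re-tuning of `m_crit` (UV-finiteness of the flavour-singlet sigma term ⇒ equicontinuity of the
gap in the renormalised mass, uniformly in the cutoff).  The route header's own two-layer plan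
(FiniteVolumeEuler at fixed `(k, S)` → VolumeUniformPassage) is NOT typeable over existing declarations: a
finite-torus "gap" read off `qcdLatticeConnectedCorr` at one `S` is vacuous (finitely many separations), and
the tree has no transfer matrix for Wilson-fermion QCD; both stubs below therefore stay in the crux's own
currency `QCDScheme.HasLatticeMassGap` (constants uniform in `k` and in the volume), which is what makes them
compose.

* `stub_cornerDescent : CornerDescentStmt` (open-problem; the Euler physics) — for a regularisation pinned
  EXACTLY at the intrinsic corner (`IsCorner reg reg.mcrit`: eventually `reg.mcrit k` IS the least upper
  bound of the non-massive degenerate bare masses at `β_k`), with leading-log mass scaling and two-loop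
  asymptotic scaling, at every positive tuple `m` whose bare masses `m_crit(k) + a_k m_f/Z_m(k)` lie in
  Lüscher's positivity range `(−1, ∞)` eventually: gap `Δ` at `l·m` (`l ≥ 1`) ⇒ gap `Δ'` at `m` for every
  `0 < Δ' < Δ/l`.  This is the crux with the pin error set to zero — the ray from the corner through the
  tuple is then an honest line of constant renormalised mass RATIOS, along which `G/t` antitone is exactly
  `Σ_f (m₀,f − m_c) ∂_f G ≤ G` (sigma share ≤ 1 ⇔ `∂Δ/∂Λ|_m ≥ 0`).
* `stub_repinInvariance : RepinInvarianceStmt` (size L; UV robustness of the pin) — for `reg`, a second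
  critical-mass sequence `mc` with `(reg.mcrit − mc)·Z_m/a → 0`, ONE of the two being the exact corner, mass
  scaling and asymptotic scaling, and a positive tuple `m` at which BOTH bare trajectories are eventually in
  Lüscher's range: gap `Δ` for `reg.scheme m 0 0` ⇒ gap `Δ'` for the re-pinned `(repin reg mc).scheme m 0 0`
  for every `0 < Δ' < Δ` (`repin reg mc = {reg with mcrit := mc}`).  At step `k` the re-pinned trajectory is
  `reg`'s trajectory at the flavour-blind shifted tuple `m − e_k·1`, `e_k → 0`: the statement is lower
  semicontinuity of the volume-uniform gap rate in the renormalised mass, UNIFORMLY in the cutoff, at tuples a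
  fixed positive renormalised distance above the corner.  It does NOT give the crux by itself (no descent in
  `l`), and the descent stub does not give the crux by itself (the crux's `reg` is not pinned exactly).

`RayDescent_of : __Registered.stub_cornerDescent → __Registered.stub_repinInvariance → RayDescent` (the aliases are
`rfl`-equal to `CornerDescentStmt`, `RepinInvarianceStmt`) is kernel-checked: with
`e_k := (m_crit(k) − mc(k)) Z_m(k)/a_k → 0`, eventually `e_k < m_f` for every flavour, so both trajectories at
the tuples `m` and `l·m` are in Lüscher's range (`mc + a X/Z_m = m_crit + (a/Z_m)(X − e) > m_crit > −1`);
choose `Δ' < Δ₂ < Δ₁/l < Δ/l`; transfer the gap `Δ` at `l·m` to the corner-pinned `repin reg mc` (rate `Δ₁`,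
re-pin stub with the corner on the target side), descend to `m` (rate `Δ₂`, descent stub — `repin reg mc` IS
pinned exactly, and mass/asymptotic scaling read only `a, Z_m, β`), transfer back (rate `Δ'`, re-pin stub with
the corner on the source side and pin `−e_k → 0`; `repin (repin reg mc) reg.mcrit = reg`).
`rayDescent_of_stubs : RayDescent` instantiates it.

## Negative knowledge honoured (read 2026-08-17)
* `Cruxes/RayDescent/` had NO workfiles before this one (no `Disproof.lean`, no dead lines, no crux ideas);
  the crux's evidence is the refuter route-review REVIEW-EulerDescent.md (elaborates rc0; unrefutable and
  unprovable cheaply; Euler share ≤ 1 checked on paper in the GMOR, decoupling, heavy-light and quarkonium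
  regimes; notes: the `N_f ∈ {2,3}` guard is missing on this crux only — the stubs inherit the crux's
  unguarded `∀ N_f` because the composition must conclude the crux as filed; `N_f = 0` makes `IsCorner`
  false (the non-massive set is `∅` or `univ`), so no stub is junk-refutable there).
* `ledger negatives --problem QuantumFields` — none concerns mass transport / re-pinning; lessons applied:
  no hand-picked constant (all rates `Δ' < Δ`, `Δ' < Δ/l` strict and universally quantified — typing
  checklist 4c (iv)), the corner clause is a VERBATIM copy of the crux's sub-formula (`MassiveAt`,
  `IsCorner`), the Lüscher clauses are stated on the bare masses actually used (derivable from the crux's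
  `m_crit > −1` and the pin, nothing smuggled).
* Junk values: `qcdTorusExpect` is junk `0` when the twisted partition function vanishes, exactly as in the
  crux itself (same currency `HasLatticeMassGap`; no new exposure).

## BC3 probes (planner folder `bc/probes.lean`): for each stub statement `S`, `S → RayDescent` and `S → QCD`
by `first | exact? | simpa [S] | (unfold S; simpa) | aesop` FAIL (rc and goals in NOTES.md / birth.md).
-/

noncomputable section

namespace Summit.QuantumFields.QCD.Cruxes.RayDescent.Birth

open scoped Topology
open Filter
open Literature.MathematicalPhysics.QuantumFieldTheory
open Summit.QuantumFields.QCD.Theses.EulerDescent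

/-! ## §0 Currency — verbatim sub-formulas of the crux -/

/-- **Lattice QCD at coupling `β` and DEGENERATE bare Wilson mass `μ` is massive** (verbatim the clause the
crux negates inside its corner set): every pair of gauge-invariant local observables clusters at some lattice
rate, uniformly in the volume. -/
def MassiveAt (Nf : ℕ) (β μ : ℝ) : Prop :=
  ∀ (R R' : ℕ) (A : QCDLatticeObservable Nf R) (B : QCDLatticeObservable Nf R'),
    ∃ (C δ : ℝ) (S₀ : ℕ), 0 < δ ∧ ∀ S : ℕ, S₀ ≤ S → ∀ n : ℕ, n ≤ S →
      ‖qcdLatticeConnectedCorr β (2 * S + 1) (fun _ : Fin Nf => μ) A B n‖ ≤ C * Real.exp (-(δ * n))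

/-- **`c` is (eventually) the INTRINSIC Wilson corner of `reg`'s coupling sequence** (verbatim the crux's
corner hypothesis, with the candidate `c` in place of `mc`): `c k` is the least upper bound of the degenerate
bare masses at which lattice QCD at `β_k` is not massive. -/
def IsCorner {Nf : ℕ} (reg : QCDRegularisation Nf) (c : ℕ → ℝ) : Prop :=
  ∀ᶠ k in atTop, IsLUB {μ : ℝ | ¬ MassiveAt Nf (reg.β k) μ} (c k)

/-- **Re-pinning**: the regularisation with the same `a, β, L, Z_m` and critical-mass sequence `mc`. -/
def repin {Nf : ℕ} (reg : QCDRegularisation Nf) (mc : ℕ → ℝ) : QCDRegularisation Nf :=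
  { reg with mcrit := mc }

section repin_lemmas

variable {Nf : ℕ} (reg : QCDRegularisation Nf) (mc : ℕ → ℝ)

/-- Re-pinning back to the original critical mass is the identity. [folklore] -/
@[simp] theorem repin_repin : repin (repin reg mc) reg.mcrit = reg := by
  cases reg
  rfl

/-- Mass scaling reads only `a, Z_m`. [folklore] -/
theorem hasMassScaling_repin (h : reg.HasMassScaling) : (repin reg mc).HasMassScaling := h

/-- Asymptotic scaling reads only `a, β`. [folklore] -/
theorem hasAsymptoticScaling_repin (h : (reg.scheme 0 0 0).HasAsymptoticScaling) :
    ((repin reg mc).scheme 0 0 0).HasAsymptoticScaling := h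

end repin_lemmas

/-! ## §1 The two stub statements -/

/-- **(A) Euler descent at the EXACT corner** (open-problem; the crux's physics).  For every `N_f` and every
regularisation `reg` whose critical mass IS eventually the intrinsic Wilson corner (`IsCorner reg reg.mcrit`),
with leading-log mass scaling and two-loop asymptotic scaling: at every positive tuple `m` whose bare masses
`m_crit(k) + a_k m_f / Z_m(k)` lie eventually in Lüscher's positivity range `(−1, ∞)`, for every `l ≥ 1` and
`Δ > 0`, a uniform lattice gap `Δ` at `l·m` gives a uniform lattice gap `Δ'` at `m` for every `0 < Δ' < Δ/l`.
Why plausibly true: along the ray from the exact corner the renormalised mass ratios are constant and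
`Δ(m) ≥ Δ(l m)/l` is `d log Δ/d log t ≤ 1`, i.e. the quark-mass (sigma) share of the lightest state is `≤ 1`
(GMOR `1/2`, heavy degenerate `2N_f/33`, quarkonium in RGI units `< 1`).  Why it might fail: a lightest state
with negative trace-anomaly share; a lattice-artefact non-massive point above the chiral corner at weak
coupling mis-identifies the LUB corner (the crux's own why-it-might-fail lives here). -/
def CornerDescentStmt : Prop :=
  ∀ (Nf : ℕ) (reg : QCDRegularisation Nf), IsCorner reg reg.mcrit → reg.HasMassScaling →
    (reg.scheme 0 0 0).HasAsymptoticScaling →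
    ∀ m : Fin Nf → ℝ, (∀ f, 0 < m f) →
      (∀ᶠ k in atTop, ∀ f, (-1 : ℝ) < reg.mcrit k + reg.a k * m f / reg.Zm k) →
      ∀ l : ℝ, 1 ≤ l → ∀ Δ : ℝ, 0 < Δ →
        (reg.scheme (fun f => l * m f) 0 0).HasLatticeMassGap Δ →
        ∀ Δ' : ℝ, 0 < Δ' → Δ' < Δ / l → (reg.scheme m 0 0).HasLatticeMassGap Δ'

/-- **(B) Sub-resolution re-pinning invariance of the uniform lattice gap** (size L; UV robustness of the
PIN).  For every `N_f`, `reg` and critical-mass sequence `mc` with `(reg.mcrit − mc)·Z_m/a → 0`, ONE of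
`reg.mcrit`, `mc` being eventually the intrinsic corner, with mass scaling and asymptotic scaling: at every
positive tuple `m` at which both bare trajectories `reg.mcrit(k) + a_k m_f/Z_m(k)` and `mc(k) + a_k m_f/Z_m(k)`
are eventually in Lüscher's range, a uniform gap `Δ` for `reg.scheme m 0 0` gives a uniform gap `Δ'` for the
re-pinned `(repin reg mc).scheme m 0 0` for every `0 < Δ' < Δ`.  Why plausibly true: at step `k` the
re-pinned trajectory is `reg`'s at the tuple `m − e_k·1` with `e_k → 0`, and `∂Δ/∂m_f^{RGI}` is the
(UV-finite) flavour-`f` sigma term of the lightest state, so the volume-uniform rate moves by `o(1)` in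
physical units — at tuples a FIXED positive renormalised distance above the corner, which the corner
hypothesis and `m_f > 0` guarantee.  Why it might fail: equicontinuity of the uniform gap in the renormalised
mass, uniformly in the cutoff, is proved for no 4D gauge theory (constants `C(A,B)` must stay `k`-uniform
across the shift); a first-order Sharpe–Singleton jump is `O(aΛ²) → 0` in physical units and does not bite. -/
def RepinInvarianceStmt : Prop :=
  ∀ (Nf : ℕ) (reg : QCDRegularisation Nf) (mc : ℕ → ℝ),
    (IsCorner reg reg.mcrit ∨ IsCorner reg mc) →
    Tendsto (fun k => (reg.mcrit k - mc k) * reg.Zm k / reg.a k) atTop (𝓝 0) →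
    reg.HasMassScaling → (reg.scheme 0 0 0).HasAsymptoticScaling →
    ∀ m : Fin Nf → ℝ, (∀ f, 0 < m f) →
      (∀ᶠ k in atTop, ∀ f, (-1 : ℝ) < reg.mcrit k + reg.a k * m f / reg.Zm k ∧
        (-1 : ℝ) < mc k + reg.a k * m f / reg.Zm k) →
      ∀ Δ : ℝ, 0 < Δ → (reg.scheme m 0 0).HasLatticeMassGap Δ →
        ∀ Δ' : ℝ, 0 < Δ' → Δ' < Δ → ((repin reg mc).scheme m 0 0).HasLatticeMassGap Δ'

/-! ## §2 The registered stubs (the ONLY `sorry`s of this file) -/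

/-- (A) Euler descent at the exact corner — open-problem. -/
theorem stub_cornerDescent : CornerDescentStmt := by
  sorry

/-- (B) sub-resolution re-pinning invariance of the uniform lattice gap — size L. -/
theorem stub_repinInvariance : RepinInvarianceStmt := by
  sorry

/-! ### Name-keyed aliases of the two stub statements — the hypotheses of `RayDescent_of`

The native skeleton audit (`#h21_check_skeleton`, run by `ledger skeleton check`) admits a hypothesis of the
composing theorem only if its head constant is a registered obligation or is NAMED like a declared stub;
`__Registered.stub_X` is the statement of `stub_X` under the stub's short name (device of
`Parity/…/Cruxes/MobiusCofactorAtom/Lines/birth.lean` and `AtomisticToContinuum/…/Cruxes/AmplitudeLDP/Lines/birth.lean`;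
the `__` namespace is an implementation detail, so the audit's stub report resolves each `stub_…` to the sorried
theorem above, not to its alias; the gate-reserved `@[stub]` attribute is not written by a planner).  Each alias
is `rfl`-equal to its statement. -/
namespace __Registered

/-- Alias of `CornerDescentStmt` keyed by the registered stub name. -/
abbrev stub_cornerDescent : Prop := CornerDescentStmt
/-- Alias of `RepinInvarianceStmt` keyed by the registered stub name. -/
abbrev stub_repinInvariance : Prop := RepinInvarianceStmt

end __Registered

/-! ## §3 Composition (kernel-checked; no `sorry` below this line) -/

/-- **The crux from the two stubs** (concludes `RayDescent` BY NAME): pin error `e_k → 0` ⇒ both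
trajectories in Lüscher's range at `m` and `l·m`; rates `Δ' < Δ₂ < Δ₁/l < Δ/l`; transfer to the corner-pinned
regularisation (B), descend there (A), transfer back (B) and `repin (repin reg mc) reg.mcrit = reg`. -/
theorem RayDescent_of :
    __Registered.stub_cornerDescent → __Registered.stub_repinInvariance → RayDescent := by
  intro hA hB Nf reg mc hcorner hpin hms haf hbranch m hm l hl Δ hΔ hgap Δ' hΔ' hlt
  -- the crux's inlined corner clause is `IsCorner reg mc` by `rfl`
  have hcorner' : IsCorner reg mc := hcorner
  have hl0 : 0 < l := lt_of_lt_of_le one_pos hl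
  -- the pin error in renormalised units
  obtain ⟨e, he⟩ : ∃ e : ℕ → ℝ, ∀ k, e k = (reg.mcrit k - mc k) * reg.Zm k / reg.a k :=
    ⟨_, fun _ => rfl⟩
  have hpe : Tendsto e atTop (𝓝 0) := by
    have h : e = fun k => (reg.mcrit k - mc k) * reg.Zm k / reg.a k := funext he
    rw [h]
    exact hpin
  have hmc : ∀ k, mc k = reg.mcrit k - reg.a k * e k / reg.Zm k := by
    intro k
    have ha : reg.a k ≠ 0 := (reg.a_pos k).ne'
    have hZ : reg.Zm k ≠ 0 := (reg.Zm_pos k).ne'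
    rw [he k]
    field_simp
    ring
  -- eventually the pin error is below every quark mass
  have hsmall : ∀ᶠ k in atTop, ∀ f, e k < m f :=
    eventually_all.2 fun f => (tendsto_order.1 hpe).2 (m f) (hm f)
  -- Lüscher's range along BOTH trajectories, at every tuple `X ≥ m`
  have hrange : ∀ X : Fin Nf → ℝ, (∀ f, m f ≤ X f) → ∀ᶠ k in atTop, ∀ f,
      (-1 : ℝ) < reg.mcrit k + reg.a k * X f / reg.Zm k ∧
        (-1 : ℝ) < mc k + reg.a k * X f / reg.Zm k := by
    intro X hX
    filter_upwards [hbranch, hsmall] with k hk hs f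
    have ha : 0 < reg.a k := reg.a_pos k
    have hZ : 0 < reg.Zm k := reg.Zm_pos k
    have hq : 0 < reg.a k / reg.Zm k := div_pos ha hZ
    have hXf : 0 < X f := (hm f).trans_le (hX f)
    have h0 : reg.a k * X f / reg.Zm k = reg.a k / reg.Zm k * X f := by ring
    constructor
    · have h1 : 0 < reg.a k / reg.Zm k * X f := mul_pos hq hXf
      linarith
    · rw [hmc k]
      have h1 : reg.mcrit k - reg.a k * e k / reg.Zm k + reg.a k * X f / reg.Zm k
          = reg.mcrit k + reg.a k / reg.Zm k * (X f - e k) := by ring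
      have h2 : 0 < X f - e k := by linarith [hs f, hX f]
      have h3 : 0 < reg.a k / reg.Zm k * (X f - e k) := mul_pos hq h2
      linarith
  -- the re-pinned regularisation IS pinned exactly at the corner, with the same scaling data
  have hcornerR : IsCorner (repin reg mc) (repin reg mc).mcrit := hcorner'
  have hmsR : (repin reg mc).HasMassScaling := hasMassScaling_repin reg mc hms
  have hafR : ((repin reg mc).scheme 0 0 0).HasAsymptoticScaling :=
    hasAsymptoticScaling_repin reg mc haf
  -- intermediate rates `Δ' < Δ₂ < Δ₁ / l < Δ / l`, `Δ₁ < Δ`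
  have hΔ'l : Δ' * l < Δ := (lt_div_iff₀ hl0).1 hlt
  obtain ⟨Δ₁, hΔ₁⟩ : ∃ Δ₁ : ℝ, Δ₁ = (l * Δ' + Δ) / 2 := ⟨_, rfl⟩
  have hlΔ' : 0 < l * Δ' := mul_pos hl0 hΔ'
  have hΔ₁pos : 0 < Δ₁ := by rw [hΔ₁]; linarith
  have hΔ₁lt : Δ₁ < Δ := by rw [hΔ₁]; nlinarith
  have hΔ'lt₁ : Δ' < Δ₁ / l := by
    rw [lt_div_iff₀ hl0, hΔ₁]
    nlinarith
  obtain ⟨Δ₂, hΔ₂⟩ : ∃ Δ₂ : ℝ, Δ₂ = (Δ' + Δ₁ / l) / 2 := ⟨_, rfl⟩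
  have hΔ₂pos : 0 < Δ₂ := by
    have : 0 < Δ₁ / l := div_pos hΔ₁pos hl0
    rw [hΔ₂]; linarith
  have hΔ'lt₂ : Δ' < Δ₂ := by rw [hΔ₂]; linarith
  have hΔ₂lt : Δ₂ < Δ₁ / l := by rw [hΔ₂]; linarith
  -- positive tuples
  have hlm : ∀ f, 0 < l * m f := fun f => mul_pos hl0 (hm f)
  have hmle : ∀ f, m f ≤ l * m f := fun f => le_mul_of_one_le_left (hm f).le hl
  -- Step 1: transfer the gap at `l·m` to the corner-pinned regularisation (rate Δ₁)
  have h1 : ((repin reg mc).scheme (fun f => l * m f) 0 0).HasLatticeMassGap Δ₁ :=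
    hB Nf reg mc (Or.inr hcorner') hpin hms haf (fun f => l * m f) hlm
      (hrange (fun f => l * m f) hmle) Δ hΔ hgap Δ₁ hΔ₁pos hΔ₁lt
  -- Step 2: Euler descent at the exact corner (rate Δ₂ at `m`)
  have hluR : ∀ᶠ k in atTop, ∀ f,
      (-1 : ℝ) < (repin reg mc).mcrit k + (repin reg mc).a k * m f / (repin reg mc).Zm k := by
    filter_upwards [hrange m fun f => le_rfl] with k hk f using (hk f).2
  have h2 : ((repin reg mc).scheme m 0 0).HasLatticeMassGap Δ₂ :=
    hA Nf (repin reg mc) hcornerR hmsR hafR m hm hluR l hl Δ₁ hΔ₁pos h1 Δ₂ hΔ₂pos hΔ₂lt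
  -- Step 3: transfer back (pin `−e_k → 0`, corner now on the source side)
  have hpin' : Tendsto (fun k => ((repin reg mc).mcrit k - reg.mcrit k) * (repin reg mc).Zm k /
      (repin reg mc).a k) atTop (𝓝 0) := by
    have h := hpin.neg
    rw [neg_zero] at h
    refine h.congr' (Eventually.of_forall fun k => ?_)
    show -((reg.mcrit k - mc k) * reg.Zm k / reg.a k) = (mc k - reg.mcrit k) * reg.Zm k / reg.a k
    ring
  have hluB : ∀ᶠ k in atTop, ∀ f,
      (-1 : ℝ) < (repin reg mc).mcrit k + (repin reg mc).a k * m f / (repin reg mc).Zm k ∧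
        (-1 : ℝ) < reg.mcrit k + (repin reg mc).a k * m f / (repin reg mc).Zm k := by
    filter_upwards [hrange m fun f => le_rfl] with k hk f using ⟨(hk f).2, (hk f).1⟩
  have h3 := hB Nf (repin reg mc) reg.mcrit (Or.inl hcornerR) hpin' hmsR hafR m hm hluB
    Δ₂ hΔ₂pos h2 Δ' hΔ' hΔ'lt₂
  rwa [repin_repin] at h3

/-- The crux along this skeleton, from the registered stubs (sorries only inside `stub_*`). -/
theorem rayDescent_of_stubs : RayDescent :=
  RayDescent_of stub_cornerDescent stub_repinInvariance

end Summit.QuantumFields.QCD.Cruxes.RayDescent.Birth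

end
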